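import Summits.FinalStateConjecture.FinalStateConjecture.Theses.NoNullFinalMomentum
import Summits.FinalStateConjecture.FinalStateConjecture.Theses.BondiDrainDispersal
import HarnessLib.Audit

/-!
# Restatement surgery for the TWIN route `NoNullFinalMomentum` over crux stmt-FinalStateConjecture-17283
# `DrainImpliesDisperse` (lead c7, 2026-08-17)

Scratch file for the PLANNER of route `NoNullFinalMomentum` (kernel-checked against the tree; nothing here is proposed to
the tree by this seat — route files and statement items are planner business, D-0014/D-0019). Companion of
`Surgery_c6.lean`, which did the same for route `BondiDrainDispersal` and whose recommendation that route's planner has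
since EXECUTED (rev 7, 2026-08-17T16:54Z: `DrainImpliesDisperseCKH` = stmt-18656 added, `closes` re-glued, 17283 kept as an
aside). The twin route still stakes its deciding theorem
`NoNullFinalMomentum.closes : DrainImpliesDisperse → GenericMassiveSettle → FinalStateConjecture` on the item AS FILED,
which six leads (REPORT-c2 … c7) report false as typed on the rough part DR ∖ CK of the admissible class (3D focusing loses
one derivative: REPORT-c3 §2; `¬ DrainImpliesDisperse` kernel-checked modulo `RoughFramedAxisPulses(Data)DevelopmentExists`,
`Theorems/DrainImpliesDisperse/Negative/`) and an open problem on its CK part. This file spells out the twin's repair,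
fully qualified and in the route file's style, and proves that the twin's deciding theorem survives it:

* `DrainImpliesDisperseCK` (C′) — the item as filed restricted to data with a sole strongly asymptotically flat
  CHRISTODOULOU–KLAINERMAN end (`AFEnd.IsStronglyAsymptoticallyFlatCK`, orders (4, 3)); byte-identical to
  `Surgery_c6.DrainImpliesDisperseCK`; no horizonless hypothesis (the twin's case split is drain / no-drain and has no
  horizon predicate in context). Implied by the item as filed (`drainImpliesDisperseCK_of`, both copies).
* `GenericMassiveOrRoughSettle` — the twin's residual `GenericMassiveSettle` with its settling clause demanded when the
  final Bondi rest mass does NOT vanish OR the datum has NO sole CK end: the weakest single generic property `Q` with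
  `Q ∧ C′ ⇒` the Statement's property pointwise (tame Christodoulou genericity is monotone in the property but not
  `∧`-closed, so the rough drained data must ride inside the one generic quantifier — exactly the R4 device of
  `Surgery_c6` / BDD rev 7). It implies the old residual (`genericMassiveSettle_of_genericMassiveOrRoughSettle`) and is
  implied by the Statement (`genericMassiveOrRoughSettle_of_finalStateConjecture`: no overshoot).
* `closes_R` — `DrainImpliesDisperseCK → GenericMassiveOrRoughSettle → FinalStateConjecture`, the re-glued deciding theorem
  (pure logic: excluded middle on the final Bondi rest mass, then on CK-regularity of the datum).

Recommended filing (as BDD rev 7 did, and for the same reason — a `--restate` in place would break the twelve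
`Theorems/` and `Cruxes/` modules that name `NoNullFinalMomentum.DrainImpliesDisperse` /
`BondiDrainDispersal.DrainImpliesDisperse`): ADD the two decls, re-glue `closes := closes_R`, keep stmt-17283 as an aside.
Every proof is pure logic; axioms `propext`, `Classical.choice`, `Quot.sound`.
-/

noncomputable section

-- every `Summit.FinalStateConjecture.FinalStateConjecture.…` name repeats the summit = sub-problem segment (D-0017 layout)
set_option linter.dupNamespace false

open scoped Manifold ContDiff Topology
open Filter Set Topology Literature.Geometry.Lorentzian

namespace Summit.FinalStateConjecture.FinalStateConjecture.Cruxes.DrainImpliesDisperse.SurgeryNNFM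

open Summit.FinalStateConjecture.FinalStateConjecture.Theses.NoNullFinalMomentum
  (DrainImpliesDisperse GenericMassiveSettle TrappedImpliesMassive)

/-! ## 1. The restated crux C′ and the enlarged residual -/

/-- **C′ — `DrainImpliesDisperse` restricted to CK-admissible data** (byte-identical to
`Surgery_c6.DrainImpliesDisperseCK`; REPORT-c3 §5 R1, REPORT-c5 §2, REPORT-c6 §0). For every admissible datum `D` with a
sole strongly asymptotically flat Christodoulou–Klainerman end and every maximal vacuum Cauchy development `𝒟` of `D` with
complete future null infinity (sojourn form): if the final Bondi rest mass vanishes, `𝒟` carries the Statement's honest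
`N = 0` decomposition verbatim. [cite: Christodoulou1999, p. A24] -/
def DrainImpliesDisperseCK : Prop :=
  ∀ (X : Type) [TopologicalSpace X] [ChartedSpace Literature.Geometry.Lorentzian.E3 X]
    [IsManifold (𝓡 3) ((⊤ : ℕ∞) : WithTop ℕ∞) X] [T2Space X] [SecondCountableTopology X] [ConnectedSpace X],
    ∀ D ∈ Literature.Geometry.Lorentzian.admissibleVacuumData X,
      (∃ (e : Literature.Geometry.Lorentzian.AFEnd X) (M : ℝ), e.IsSoleEnd ∧ e.IsStronglyAsymptoticallyFlatCK D M) →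
    ∀ 𝒟 : Literature.Geometry.Lorentzian.VacuumCauchyDevelopment D, 𝒟.IsMaximal →
      Summit.FinalStateConjecture.HasCompleteNullInfinity 𝒟.toCauchyDevelopment →
      𝒟.toCauchyDevelopment.HasVanishingFinalBondiMass →
      ∃ (O : Set 𝒟.carrier) (d : Literature.Geometry.Lorentzian.FinalStateDecomposition 𝒟.toSpacetime O 2),
        d.N = 0 ∧ O = Summit.FinalStateConjecture.exteriorOf 𝒟.toCauchyDevelopment d.charted ∧
          Summit.FinalStateConjecture.RaysStayInClosure 𝒟.toCauchyDevelopment O ∧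
          Summit.FinalStateConjecture.HasExhaustiveCharts d ∧ Summit.FinalStateConjecture.IsFutureOriented d

/-- **The enlarged residual `GenericMassiveOrRoughSettle`**: for every data manifold `X`, TAME-Christodoulou-generically
in the admissible class (`IsTameChristodoulouGeneric (admissibleVacuumData X) · 1`): an MGHD exists, and every MGHD has
complete `𝓘⁺` and, IF its final Bondi rest mass does NOT vanish OR the datum has NO sole strongly asymptotically flat CK
end (the rough class DR ∖ CK), admits `O` and a `C²` final-state decomposition `d` with every `(d.mass i, d.spin i)`
sub-extremal, `O = exteriorOf d.charted`, `RaysStayInClosure O`, `HasExhaustiveCharts d`, `IsFutureOriented d`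
(`GenericMassiveSettle` with `¬ HasVanishingFinalBondiMass →` replaced by `(¬ HasVanishingFinalBondiMass ∨ ¬ CK) →`).
[cite: Christodoulou1999, p. A24] -/
def GenericMassiveOrRoughSettle : Prop :=
  ∀ (X : Type) [TopologicalSpace X] [ChartedSpace Literature.Geometry.Lorentzian.E3 X]
    [IsManifold (𝓡 3) ((⊤ : ℕ∞) : WithTop ℕ∞) X] [T2Space X] [SecondCountableTopology X] [ConnectedSpace X],
    Literature.Geometry.Lorentzian.InitialDataSet.IsTameChristodoulouGeneric
      (Literature.Geometry.Lorentzian.admissibleVacuumData X)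
      (fun D ↦ (∃ 𝒟 : Literature.Geometry.Lorentzian.VacuumCauchyDevelopment D, 𝒟.IsMaximal) ∧
        ∀ 𝒟 : Literature.Geometry.Lorentzian.VacuumCauchyDevelopment D, 𝒟.IsMaximal →
          Summit.FinalStateConjecture.HasCompleteNullInfinity 𝒟.toCauchyDevelopment ∧
          ((¬ 𝒟.toCauchyDevelopment.HasVanishingFinalBondiMass ∨
              ¬ (∃ (e : Literature.Geometry.Lorentzian.AFEnd X) (M : ℝ),
                  e.IsSoleEnd ∧ e.IsStronglyAsymptoticallyFlatCK D M)) →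
            ∃ (O : Set 𝒟.carrier) (d : Literature.Geometry.Lorentzian.FinalStateDecomposition 𝒟.toSpacetime O 2),
              (∀ i, Literature.Geometry.Lorentzian.Kerr.IsSubextremal (d.mass i) (d.spin i)) ∧
              O = Summit.FinalStateConjecture.exteriorOf 𝒟.toCauchyDevelopment d.charted ∧
              Summit.FinalStateConjecture.RaysStayInClosure 𝒟.toCauchyDevelopment O ∧
              Summit.FinalStateConjecture.HasExhaustiveCharts d ∧
              Summit.FinalStateConjecture.IsFutureOriented d)) 1

/-! ## 2. Monotonicity: nothing landed is lost, nothing overshoots -/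

/-- The item as filed (twin copy) implies C′. [folklore] -/
theorem drainImpliesDisperseCK_of (h : DrainImpliesDisperse) : DrainImpliesDisperseCK :=
  fun X _ _ _ _ _ _ D hD _ 𝒟 h𝒟 hI hM ↦ h X D hD 𝒟 h𝒟 hI hM

/-- The item as filed (BondiDrainDispersal copy, `Iff.rfl` twin) implies C′. [folklore] -/
theorem drainImpliesDisperseCK_of_bdd
    (h : Summit.FinalStateConjecture.FinalStateConjecture.Theses.BondiDrainDispersal.DrainImpliesDisperse) :
    DrainImpliesDisperseCK :=
  fun X _ _ _ _ _ _ D hD _ 𝒟 h𝒟 hI hM ↦ h X D hD 𝒟 h𝒟 hI hM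

/-- C′ here is the C′ the BondiDrainDispersal crux C″ (stmt-18656, `DrainImpliesDisperseCKH`) weakens: C′ ⇒ C″ (the
horizonless hypothesis is simply dropped). [folklore] -/
theorem drainImpliesDisperseCKH_of_CK (h : DrainImpliesDisperseCK) :
    Summit.FinalStateConjecture.FinalStateConjecture.Theses.BondiDrainDispersal.DrainImpliesDisperseCKH :=
  fun X _ _ _ _ _ _ D hD hCK 𝒟 h𝒟 hI _ hM ↦ h X D hD hCK 𝒟 h𝒟 hI hM

/-- The enlarged residual implies the old one (`GenericMassiveSettle`): its settling clause is demanded on a larger set of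
developments, and tame genericity is monotone in the property (the SAME end and the SAME tame immersed injective family
witness the smaller exceptional set). [folklore] -/
theorem genericMassiveSettle_of_genericMassiveOrRoughSettle (hG : GenericMassiveOrRoughSettle) :
    GenericMassiveSettle := by
  intro X _ _ _ _ _ _ D hD
  have key : ∀ D' ∈ Literature.Geometry.Lorentzian.admissibleVacuumData X,
      ((∃ 𝒟 : Literature.Geometry.Lorentzian.VacuumCauchyDevelopment D', 𝒟.IsMaximal) ∧
        ∀ 𝒟 : Literature.Geometry.Lorentzian.VacuumCauchyDevelopment D', 𝒟.IsMaximal →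
          Summit.FinalStateConjecture.HasCompleteNullInfinity 𝒟.toCauchyDevelopment ∧
          ((¬ 𝒟.toCauchyDevelopment.HasVanishingFinalBondiMass ∨
              ¬ (∃ (e : Literature.Geometry.Lorentzian.AFEnd X) (M : ℝ),
                  e.IsSoleEnd ∧ e.IsStronglyAsymptoticallyFlatCK D' M)) →
            ∃ (O : Set 𝒟.carrier) (d : Literature.Geometry.Lorentzian.FinalStateDecomposition 𝒟.toSpacetime O 2),
              (∀ i, Literature.Geometry.Lorentzian.Kerr.IsSubextremal (d.mass i) (d.spin i)) ∧
              O = Summit.FinalStateConjecture.exteriorOf 𝒟.toCauchyDevelopment d.charted ∧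
              Summit.FinalStateConjecture.RaysStayInClosure 𝒟.toCauchyDevelopment O ∧
              Summit.FinalStateConjecture.HasExhaustiveCharts d ∧
              Summit.FinalStateConjecture.IsFutureOriented d)) →
      ((∃ 𝒟 : Literature.Geometry.Lorentzian.VacuumCauchyDevelopment D', 𝒟.IsMaximal) ∧
        ∀ 𝒟 : Literature.Geometry.Lorentzian.VacuumCauchyDevelopment D', 𝒟.IsMaximal →
          Summit.FinalStateConjecture.HasCompleteNullInfinity 𝒟.toCauchyDevelopment ∧
          (¬ 𝒟.toCauchyDevelopment.HasVanishingFinalBondiMass →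
            ∃ (O : Set 𝒟.carrier) (d : Literature.Geometry.Lorentzian.FinalStateDecomposition 𝒟.toSpacetime O 2),
              (∀ i, Literature.Geometry.Lorentzian.Kerr.IsSubextremal (d.mass i) (d.spin i)) ∧
              O = Summit.FinalStateConjecture.exteriorOf 𝒟.toCauchyDevelopment d.charted ∧
              Summit.FinalStateConjecture.RaysStayInClosure 𝒟.toCauchyDevelopment O ∧
              Summit.FinalStateConjecture.HasExhaustiveCharts d ∧
              Summit.FinalStateConjecture.IsFutureOriented d)) := by
    intro D' _ h
    exact ⟨h.1, fun 𝒟 h𝒟 ↦ ⟨(h.2 𝒟 h𝒟).1, fun hM ↦ (h.2 𝒟 h𝒟).2 (Or.inl hM)⟩⟩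
  obtain ⟨e, F, hT, hI, h0, hinj, hF𝓓, hE⟩ := hG X D ⟨hD.1, fun h ↦ hD.2 (key D hD.1 h)⟩
  exact ⟨e, F, hT, hI, h0, hinj, hF𝓓, fun c hc hmem ↦ hE c hc ⟨hmem.1, fun h ↦ hmem.2 (key _ hmem.1 h)⟩⟩

/-- The enlarged residual is implied by the Statement itself (so the surgery does not overshoot the summit): the
Statement's property gives the decomposition unconditionally. [folklore] -/
theorem genericMassiveOrRoughSettle_of_finalStateConjecture (h : _root_.FinalStateConjecture) :
    GenericMassiveOrRoughSettle := by
  intro X _ _ _ _ _ _ D hD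
  have key : ∀ D' ∈ Literature.Geometry.Lorentzian.admissibleVacuumData X,
      ((∃ 𝒟 : Literature.Geometry.Lorentzian.VacuumCauchyDevelopment D', 𝒟.IsMaximal) ∧
        ∀ 𝒟 : Literature.Geometry.Lorentzian.VacuumCauchyDevelopment D', 𝒟.IsMaximal →
          Summit.FinalStateConjecture.HasCompleteNullInfinity 𝒟.toCauchyDevelopment ∧
            ∃ (O : Set 𝒟.carrier) (d : Literature.Geometry.Lorentzian.FinalStateDecomposition 𝒟.toSpacetime O 2),
              (∀ i, Literature.Geometry.Lorentzian.Kerr.IsSubextremal (d.mass i) (d.spin i)) ∧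
              O = Summit.FinalStateConjecture.exteriorOf 𝒟.toCauchyDevelopment d.charted ∧
              Summit.FinalStateConjecture.RaysStayInClosure 𝒟.toCauchyDevelopment O ∧
              Summit.FinalStateConjecture.HasExhaustiveCharts d ∧
              Summit.FinalStateConjecture.IsFutureOriented d) →
      ((∃ 𝒟 : Literature.Geometry.Lorentzian.VacuumCauchyDevelopment D', 𝒟.IsMaximal) ∧
        ∀ 𝒟 : Literature.Geometry.Lorentzian.VacuumCauchyDevelopment D', 𝒟.IsMaximal →
          Summit.FinalStateConjecture.HasCompleteNullInfinity 𝒟.toCauchyDevelopment ∧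
          ((¬ 𝒟.toCauchyDevelopment.HasVanishingFinalBondiMass ∨
              ¬ (∃ (e : Literature.Geometry.Lorentzian.AFEnd X) (M : ℝ),
                  e.IsSoleEnd ∧ e.IsStronglyAsymptoticallyFlatCK D' M)) →
            ∃ (O : Set 𝒟.carrier) (d : Literature.Geometry.Lorentzian.FinalStateDecomposition 𝒟.toSpacetime O 2),
              (∀ i, Literature.Geometry.Lorentzian.Kerr.IsSubextremal (d.mass i) (d.spin i)) ∧
              O = Summit.FinalStateConjecture.exteriorOf 𝒟.toCauchyDevelopment d.charted ∧
              Summit.FinalStateConjecture.RaysStayInClosure 𝒟.toCauchyDevelopment O ∧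
              Summit.FinalStateConjecture.HasExhaustiveCharts d ∧
              Summit.FinalStateConjecture.IsFutureOriented d)) := by
    intro D' _ h'
    exact ⟨h'.1, fun 𝒟 h𝒟 ↦ ⟨(h'.2 𝒟 h𝒟).1, fun _ ↦ (h'.2 𝒟 h𝒟).2⟩⟩
  obtain ⟨e, F, hT, hI, h0, hinj, hF𝓓, hE⟩ := h X D ⟨hD.1, fun h' ↦ hD.2 (key D hD.1 h')⟩
  exact ⟨e, F, hT, hI, h0, hinj, hF𝓓, fun c hc hmem ↦ hE c hc ⟨hmem.1, fun h' ↦ hmem.2 (key _ hmem.1 h')⟩⟩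

/-! ## 3. The re-glued deciding theorem of the twin route -/

/-- **The twin route's deciding theorem after the surgery**: `DrainImpliesDisperseCK → GenericMassiveOrRoughSettle →
FinalStateConjecture`. Pure logic: fix `X` and an exceptional datum `D` of the Statement's property `P`; tame Christodoulou
genericity is monotone in the property, so it suffices that the residual's property `Q` implies `P` on the admissible
class; given an MGHD `𝒟`, `Q` gives complete `𝓘⁺`, and by excluded middle either the final Bondi rest mass does not vanish
(`Q` settles), or it vanishes and the datum is CK-regular (C′ gives the `N = 0` decomposition, sub-extremality vacuous
over `Fin 0`), or it vanishes and the datum is rough (`Q` again). [folklore] -/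
theorem closes_R : DrainImpliesDisperseCK → GenericMassiveOrRoughSettle → _root_.FinalStateConjecture := by
  intro hA hG X _ _ _ _ _ _ D hD
  have key : ∀ D' ∈ Literature.Geometry.Lorentzian.admissibleVacuumData X,
      ((∃ 𝒟 : Literature.Geometry.Lorentzian.VacuumCauchyDevelopment D', 𝒟.IsMaximal) ∧
        ∀ 𝒟 : Literature.Geometry.Lorentzian.VacuumCauchyDevelopment D', 𝒟.IsMaximal →
          Summit.FinalStateConjecture.HasCompleteNullInfinity 𝒟.toCauchyDevelopment ∧
          ((¬ 𝒟.toCauchyDevelopment.HasVanishingFinalBondiMass ∨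
              ¬ (∃ (e : Literature.Geometry.Lorentzian.AFEnd X) (M : ℝ),
                  e.IsSoleEnd ∧ e.IsStronglyAsymptoticallyFlatCK D' M)) →
            ∃ (O : Set 𝒟.carrier) (d : Literature.Geometry.Lorentzian.FinalStateDecomposition 𝒟.toSpacetime O 2),
              (∀ i, Literature.Geometry.Lorentzian.Kerr.IsSubextremal (d.mass i) (d.spin i)) ∧
              O = Summit.FinalStateConjecture.exteriorOf 𝒟.toCauchyDevelopment d.charted ∧
              Summit.FinalStateConjecture.RaysStayInClosure 𝒟.toCauchyDevelopment O ∧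
              Summit.FinalStateConjecture.HasExhaustiveCharts d ∧
              Summit.FinalStateConjecture.IsFutureOriented d)) →
      ((∃ 𝒟 : Literature.Geometry.Lorentzian.VacuumCauchyDevelopment D', 𝒟.IsMaximal) ∧
        ∀ 𝒟 : Literature.Geometry.Lorentzian.VacuumCauchyDevelopment D', 𝒟.IsMaximal →
          Summit.FinalStateConjecture.HasCompleteNullInfinity 𝒟.toCauchyDevelopment ∧
            ∃ (O : Set 𝒟.carrier) (d : Literature.Geometry.Lorentzian.FinalStateDecomposition 𝒟.toSpacetime O 2),
              (∀ i, Literature.Geometry.Lorentzian.Kerr.IsSubextremal (d.mass i) (d.spin i)) ∧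
              O = Summit.FinalStateConjecture.exteriorOf 𝒟.toCauchyDevelopment d.charted ∧
              Summit.FinalStateConjecture.RaysStayInClosure 𝒟.toCauchyDevelopment O ∧
              Summit.FinalStateConjecture.HasExhaustiveCharts d ∧
              Summit.FinalStateConjecture.IsFutureOriented d) := by
    intro D' hD' h
    refine ⟨h.1, fun 𝒟 h𝒟 ↦ ⟨(h.2 𝒟 h𝒟).1, ?_⟩⟩
    by_cases hM : 𝒟.toCauchyDevelopment.HasVanishingFinalBondiMass
    · by_cases hCK : ∃ (e : Literature.Geometry.Lorentzian.AFEnd X) (M : ℝ),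
          e.IsSoleEnd ∧ e.IsStronglyAsymptoticallyFlatCK D' M
      · -- drained, CK-regular datum: the restricted dispersive crux C′
        obtain ⟨O, d, hN, hO, hR, hE, hF⟩ := hA X D' hD' hCK 𝒟 h𝒟 (h.2 𝒟 h𝒟).1 hM
        exact ⟨O, d, fun i ↦ (Fin.cast hN i).elim0, hO, hR, hE, hF⟩
      · -- drained, rough datum (DR ∖ CK): owned by the generic residual
        exact (h.2 𝒟 h𝒟).2 (Or.inr hCK)
    · -- massive: the generic residual settles the exterior
      exact (h.2 𝒟 h𝒟).2 (Or.inl hM)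
  obtain ⟨e, F, hT, hI, h0, hinj, hF𝓓, hE⟩ := hG X D ⟨hD.1, fun h ↦ hD.2 (key D hD.1 h)⟩
  exact ⟨e, F, hT, hI, h0, hinj, hF𝓓, fun c hc hmem ↦ hE c hc ⟨hmem.1, fun h ↦ hmem.2 (key _ hmem.1 h)⟩⟩

/-- The twin's CURRENT deciding theorem factors through the surgery (sanity: the new glue is not weaker than the old
route — the old hypotheses give the new ones). [folklore] -/
theorem closes_of_closes_R (hA : DrainImpliesDisperse) (hG : GenericMassiveOrRoughSettle) :
    _root_.FinalStateConjecture :=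
  closes_R (drainImpliesDisperseCK_of hA) hG



end Summit.FinalStateConjecture.FinalStateConjecture.Cruxes.DrainImpliesDisperse.SurgeryNNFM
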